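import Summits.HubbardSuperconductivity.HubbardSuperconductivity.Theses.WeakCouplingBCS
import Literature.MathematicalPhysics.QuantumLattice.DWaveOrderParameterProofs

/-!
# Bottom-stair stubs are the crux's order clause in costume — kernel-checked certificate

Crux `WeakCouplingBCS.WcbcsBcsConstruction` (item stmt-HubbardSuperconductivity-2010), lead seat c1, 2026-08-16.
Evidence for `Lines/weyl-envelope-cooper-flow.dead.md` and `Lines/source-staircase-nambu-dirac.dead.md`.

Write `F(U,μ,h) := liminf_L dWaveSourceDensity (L+1) U μ h` (the "stair" at source strength `h`) and
`m(U,μ) := dWaveOrderParameter U μ = liminf_{h→0⁺} F(U,μ,h) = ⨅_{h>0} F(U,μ,h)` (tree: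
`dWaveOrderParameter_eq_iInf`; `F` is non-decreasing and `≥ 0` on `h ≥ 0`).

* §1 `bottomStair_iff`: a floor `ε` on the stairs of ANY punctured interval `(0,h_I)` is EXACTLY the order floor
  `ε ≤ m(U,μ)`. So every line that splits the crux along the source axis `h` and keeps a stub of the form
  "`∀ h ∈ (0,h_I], floor ≤ F(U,μ,h)`" keeps the crux's order clause verbatim (up to the value of the floor).
* §2 the shape of `weyl-envelope-cooper-flow`'s `stub_brokenPhasePersistence` ("imported bottom stair:
  `e^{-C/U²}F(h_I) ≤ F(h)` on `(0,h_I]`", planner's evidence note 2026-08-15T23:58:53Z):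
  `BPP U μ C h_I ↔ e^{-C/U²}·F(U,μ,h_I) ≤ m(U,μ)` (`bpp_iff`); the crux's order floor `e^{-C/U²} ≤ m(U,μ)` implies
  `BPP U μ (C+2) h_I` for `U ≤ 1` (`bpp_of_orderFloor`), and `BPP` plus the line's window floor
  `e^{-C₁/U²} ≤ F(U,μ,h_I)` gives back the order floor with `C + C₁` (`orderFloor_of_bpp`). The stub is thus implied by
  the crux at the crux's own `μ(U)` and carries its entire symmetry-breaking content.
* §3 the shape of `source-staircase-nambu-dirac`'s `stub_dressedBcsFloor` ("bottom stairs `h ≤ e^{-1/(κU²)}`, uniform in a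
  `(δ,μ)`-box", planner's note 2026-08-15T23:55:31Z): uniformly in any box it is EXACTLY the order floor on that box
  (`dbf_iff`) — the crux's order clause made uniform in `μ`, i.e. a strengthening of it.
No statement here refers to the unreadable skeleton files; only the published SHAPES are formalised, with the
threshold functions (`h_I`, `h⋆`) arbitrary.
-/

set_option linter.dupNamespace false

namespace Summit.HubbardSuperconductivity.HubbardSuperconductivity.Cruxes.WcbcsBcsConstruction.BottomStairCostume

open Literature.MathematicalPhysics.QuantumLattice Literature.Probability.LatticeModels Filter Finset
open scoped Topology

noncomputable section

/-- The stair function `F(U,μ,h) = liminf_L dWaveSourceDensity (L+1) U μ h`. -/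
def F (U μ h : ℝ) : ℝ := liminf (fun L : ℕ => dWaveSourceDensity (L + 1) U μ h) atTop

/-- The a priori constant `B_d = 2 Σ_{e ∈ {0,±e₁,±e₂}} |d(e)/√2|` bounding every stair. -/
def Bd : ℝ := 2 * ∑ e ∈ insert (0 : Site 2) unitSteps, |dWaveFormFactor e / Real.sqrt 2|

theorem F_le_Bd (U μ : ℝ) {h : ℝ} (hh : 0 ≤ h) : F U μ h ≤ Bd :=
  liminf_dWaveSourceDensity_le_const U μ hh

theorem F_nonneg (U μ : ℝ) {h : ℝ} (hh : 0 ≤ h) : 0 ≤ F U μ h :=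
  liminf_dWaveSourceDensity_nonneg U μ hh

/-! ### §1 Any bottom-stair floor is exactly an order floor -/

/-- A floor on the stairs of some punctured interval `(0, h_I)` ⟺ the same floor on the order parameter. -/
theorem bottomStair_iff (U μ ε : ℝ) :
    (∃ hI : ℝ, 0 < hI ∧ ∀ h ∈ Set.Ioo 0 hI, ε ≤ F U μ h) ↔ ε ≤ dWaveOrderParameter U μ := by
  constructor
  · rintro ⟨hI, hhI, H⟩
    exact le_dWaveOrderParameter_of_forall U μ hhI H
  · intro hε
    exact ⟨1, one_pos, fun h hh => (le_dWaveOrderParameter_iff_forall U μ ε).1 hε h hh.1⟩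

/-- Closed-at-the-top variant: floor on `(0, h_I]` ⟺ order floor (for any fixed `h_I > 0`). -/
theorem bottomStair_Ioc_iff (U μ ε : ℝ) {hI : ℝ} (hhI : 0 < hI) :
    (∀ h ∈ Set.Ioc 0 hI, ε ≤ F U μ h) ↔ ε ≤ dWaveOrderParameter U μ :=
  ⟨fun H => le_dWaveOrderParameter_of_forall U μ hhI fun h hh => H h ⟨hh.1, hh.2.le⟩,
   fun hε h hh => (le_dWaveOrderParameter_iff_forall U μ ε).1 hε h hh.1⟩

/-! ### §2 `stub_brokenPhasePersistence` (weyl-envelope-cooper-flow) -/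

/-- The published shape of `stub_brokenPhasePersistence` at one `(U, μ)`: below the envelope window's bottom `h_I`,
the stair never drops by more than the factor `e^{-C/U²}` from its value at `h_I`. -/
def BPP (U μ C hI : ℝ) : Prop :=
  ∀ h ∈ Set.Ioo 0 hI, Real.exp (-C / U ^ 2) * F U μ hI ≤ F U μ h

/-- `BPP` is an order floor in disguise. -/
theorem bpp_iff (U μ C : ℝ) {hI : ℝ} (hhI : 0 < hI) :
    BPP U μ C hI ↔ Real.exp (-C / U ^ 2) * F U μ hI ≤ dWaveOrderParameter U μ :=
  ⟨fun H => le_dWaveOrderParameter_of_forall U μ hhI H,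
   fun hm _h hh => hm.trans (dWaveOrderParameter_le_liminf U μ hh.1)⟩

/-- `|d(e)| ≤ 1`. -/
theorem abs_dWaveFormFactor_le_one (e : Site 2) : |dWaveFormFactor e| ≤ 1 := by
  unfold dWaveFormFactor
  split_ifs <;> simp

/-- `B_d ≤ 5√2 ≤ e²` (crude: five summands, each `≤ 1/√2`). -/
theorem Bd_le_exp_two : Bd ≤ Real.exp 2 := by
  have hs2 : 0 < Real.sqrt 2 := Real.sqrt_pos.2 two_pos
  have hterm : ∀ e ∈ insert (0 : Site 2) unitSteps, |dWaveFormFactor e / Real.sqrt 2| ≤ 1 / Real.sqrt 2 := by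
    intro e _
    rw [abs_div, abs_of_pos hs2]
    exact div_le_div_of_nonneg_right (abs_dWaveFormFactor_le_one e) hs2.le
  have hcard : ((insert (0 : Site 2) unitSteps).card : ℝ) ≤ 5 := by
    have : (insert (0 : Site 2) unitSteps).card ≤ 5 := by
      refine (Finset.card_insert_le _ _).trans ?_
      unfold unitSteps
      refine Nat.succ_le_succ ((Finset.card_insert_le _ _).trans (Nat.succ_le_succ
        ((Finset.card_insert_le _ _).trans (Nat.succ_le_succ ((Finset.card_insert_le _ _).trans
          (Nat.succ_le_succ (by simp)))))))
    exact_mod_cast this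
  have hsum : ∑ e ∈ insert (0 : Site 2) unitSteps, |dWaveFormFactor e / Real.sqrt 2| ≤ 5 * (1 / Real.sqrt 2) := by
    refine (Finset.sum_le_card_nsmul _ _ _ hterm).trans ?_
    rw [nsmul_eq_mul]
    exact mul_le_mul_of_nonneg_right hcard (by positivity)
  have hsqrt : Real.sqrt 2 ≥ 7 / 5 := by
    rw [ge_iff_le, show (7 / 5 : ℝ) = Real.sqrt ((7 / 5) ^ 2) by rw [Real.sqrt_sq]; norm_num]
    exact Real.sqrt_le_sqrt (by norm_num)
  have h10 : Bd ≤ 10 / Real.sqrt 2 := by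
    unfold Bd
    calc 2 * ∑ e ∈ insert (0 : Site 2) unitSteps, |dWaveFormFactor e / Real.sqrt 2|
        ≤ 2 * (5 * (1 / Real.sqrt 2)) := by linarith
      _ = 10 / Real.sqrt 2 := by ring
  have h10' : 10 / Real.sqrt 2 ≤ 50 / 7 := by
    rw [div_le_div_iff₀ hs2 (by norm_num : (0:ℝ) < 7)]
    nlinarith
  have hexp : (50 / 7 : ℝ) ≤ Real.exp 2 := by
    have h1 := Real.exp_one_gt_d9
    have : Real.exp 2 = Real.exp 1 * Real.exp 1 := by rw [← Real.exp_add]; norm_num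
    rw [this]
    nlinarith [Real.exp_pos 1]
  linarith

/-- **The crux's order floor implies `stub_brokenPhasePersistence`** (with `C ↦ C + 2`, for `U ≤ 1`, ANY `h_I > 0`):
`e^{-C/U²} ≤ m(U,μ)` ⇒ `BPP U μ (C+2) h_I`. So the stub is a consequence of the order clause at the crux's own `μ(U)`. -/
theorem bpp_of_orderFloor (U μ C : ℝ) {hI : ℝ} (hhI : 0 < hI) (hU : 0 < U) (hU1 : U ≤ 1)
    (hm : Real.exp (-C / U ^ 2) ≤ dWaveOrderParameter U μ) : BPP U μ (C + 2) hI := by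
  rw [bpp_iff U μ (C + 2) hhI]
  have hF : F U μ hI ≤ Real.exp 2 := (F_le_Bd U μ hhI.le).trans Bd_le_exp_two
  have hF0 : 0 ≤ F U μ hI := F_nonneg U μ hhI.le
  have hU2 : 0 < U ^ 2 := by positivity
  have hU2le : U ^ 2 ≤ 1 := by nlinarith
  -- e^{-(C+2)/U²} · F(h_I) ≤ e^{-(C+2)/U²} · e² ≤ e^{-C/U²}
  have hsplit : Real.exp (-(C + 2) / U ^ 2) * Real.exp 2 ≤ Real.exp (-C / U ^ 2) := by
    rw [← Real.exp_add]
    refine Real.exp_le_exp.2 ?_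
    rw [show -(C + 2) / U ^ 2 + 2 = -C / U ^ 2 + (2 - 2 / U ^ 2) by ring]
    have : 2 / U ^ 2 ≥ 2 := by
      rw [ge_iff_le, le_div_iff₀ hU2]; nlinarith
    linarith
  calc Real.exp (-(C + 2) / U ^ 2) * F U μ hI
      ≤ Real.exp (-(C + 2) / U ^ 2) * Real.exp 2 :=
        mul_le_mul_of_nonneg_left hF (Real.exp_pos _).le
    _ ≤ Real.exp (-C / U ^ 2) := hsplit
    _ ≤ dWaveOrderParameter U μ := hm

/-- **Conversely, `BPP` plus the line's window floor at `h_I` is the order floor** (constants add). -/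
theorem orderFloor_of_bpp (U μ C C₁ : ℝ) {hI : ℝ} (hhI : 0 < hI) (hB : BPP U μ C hI)
    (hw : Real.exp (-C₁ / U ^ 2) ≤ F U μ hI) :
    Real.exp (-(C + C₁) / U ^ 2) ≤ dWaveOrderParameter U μ := by
  have h := (bpp_iff U μ C hhI).1 hB
  refine le_trans ?_ h
  rw [show -(C + C₁) / U ^ 2 = -C / U ^ 2 + -C₁ / U ^ 2 by ring, Real.exp_add]
  exact mul_le_mul_of_nonneg_left hw (Real.exp_pos _).le

/-! ### §3 `stub_dressedBcsFloor` (source-staircase-nambu-dirac) -/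

/-- The published shape of `stub_dressedBcsFloor`: a floor `e^{-C/U²}` on all bottom stairs `h ∈ (0, h⋆(U)]`,
uniformly for `U ∈ (0,U₁)` and `μ` in a box. -/
def DBF (C U₁ μ₁ μ₂ : ℝ) (hstar : ℝ → ℝ) : Prop :=
  ∀ U ∈ Set.Ioo 0 U₁, ∀ μ ∈ Set.Icc μ₁ μ₂, ∀ h ∈ Set.Ioc 0 (hstar U), Real.exp (-C / U ^ 2) ≤ F U μ h

/-- `DBF` is EXACTLY the crux's order floor made uniform on the box (whatever the threshold `h⋆ > 0`). -/
theorem dbf_iff (C U₁ μ₁ μ₂ : ℝ) {hstar : ℝ → ℝ} (hpos : ∀ U ∈ Set.Ioo 0 U₁, 0 < hstar U) :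
    DBF C U₁ μ₁ μ₂ hstar ↔
      ∀ U ∈ Set.Ioo 0 U₁, ∀ μ ∈ Set.Icc μ₁ μ₂, Real.exp (-C / U ^ 2) ≤ dWaveOrderParameter U μ :=
  ⟨fun H U hU μ hμ => (bottomStair_Ioc_iff U μ _ (hpos U hU)).1 (H U hU μ hμ),
   fun H U hU μ hμ => (bottomStair_Ioc_iff U μ _ (hpos U hU)).2 (H U hU μ hμ)⟩

/-! ### §4 Read-back: the crux's order clause in stair form -/

/-- The crux, with its order clause rewritten as "a floor on every stair": nothing but `Iff.rfl` and §1. -/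
theorem wcbcsBcsConstruction_iff_stairs :
    Summit.HubbardSuperconductivity.HubbardSuperconductivity.Theses.WeakCouplingBCS.WcbcsBcsConstruction ↔
      ∃ δ ∈ Set.Ioo (0:ℝ) (1 / 2), ∃ U₀ : ℝ, 0 < U₀ ∧ ∃ C : ℝ, 0 < C ∧ ∀ U ∈ Set.Ioo (0:ℝ) U₀, ∃ μ : ℝ,
        Filter.Tendsto (fun L : ℕ => ((hubbardTorusWith 2 (L + 1) 1 U μ).groundStateFunctional
          totalNumber).re / ((L + 1 : ℕ) : ℝ) ^ 2) Filter.atTop (nhds (1 - δ)) ∧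
        ∀ h : ℝ, 0 < h → Real.exp (-C / U ^ 2) ≤ F U μ h := by
  unfold Summit.HubbardSuperconductivity.HubbardSuperconductivity.Theses.WeakCouplingBCS.WcbcsBcsConstruction
  constructor
  · rintro ⟨δ, hδ, U₀, hU₀, C, hC, H⟩
    refine ⟨δ, hδ, U₀, hU₀, C, hC, fun U hU => ?_⟩
    obtain ⟨μ, hd, hm⟩ := H U hU
    exact ⟨μ, hd, (le_dWaveOrderParameter_iff_forall U μ _).1 hm⟩
  · rintro ⟨δ, hδ, U₀, hU₀, C, hC, H⟩
    refine ⟨δ, hδ, U₀, hU₀, C, hC, fun U hU => ?_⟩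
    obtain ⟨μ, hd, hm⟩ := H U hU
    exact ⟨μ, hd, (le_dWaveOrderParameter_iff_forall U μ _).2 hm⟩

end

end Summit.HubbardSuperconductivity.HubbardSuperconductivity.Cruxes.WcbcsBcsConstruction.BottomStairCostume
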